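import Summits.CriticalPhenomena.SAWScalingLimit.Theorems.SAWDefectDecoherencePolygonParitySqueezeDefs
import Summits.CriticalPhenomena.SAWScalingLimit.Theorems.SAWDefectDecoherenceBoundaryClosureRGateFrameRegular
import Literature.Analysis.Complex.InjectiveHolomorphic
import Literature.Probability.RandomPlanarGeometry.KernelConvergence
import HarnessLib

/-!
# `BoundaryClosureR` (stmt-CriticalPhenomena-14004), line `polygon-parity-squeeze`, stub
# `stub_gateStability` (GS), part I: Schwarz reflection of a conformal frame across the flat gate

Single-domain input of the gate-stability theorem (Carathéodory kernel convergence of the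
conformal gate densities of inner domains, `stub_gateStability`).  For a Dobrushin domain `D`
whose carrier `Ω` is the open upper half-disc above `b = D.pt 1` inside `B(b, s)`, with the root
`a = D.pt 0` outside `B(b, s)`, and a frame map `Φ : Ω → ℍₒ` (`‖Φ‖ → ∞` at `a`, `Φ → 0` at `b`):

* `exists_frameExtension_injOn` — the Carathéodory extension `Φ*` of `Φ` to `closure Ω ∖ {a}`
  (continuous, real on `∂Ω`) is moreover INJECTIVE there (it is `cayley⁻¹ ∘ Ψ⁻¹` for the
  Carathéodory homeomorphism `Ψ` of the closed disc onto `closure Ω`);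
* `exists_gateReflection` — the SCHWARZ REFLECTION `F` of `Φ` across the gate: holomorphic and
  injective on the full disc `B(b, s)`, equal to `Φ` on the upper half-disc, `F(b) = 0`, real on
  the diameter, with `F' > 0` (real) on the diameter (boundary Hopf lemma at `b`, injectivity and
  the intermediate value theorem along the diameter).

References: Pommerenke, *Boundary Behaviour of Conformal Maps* (1992), Thm. 2.6; Conway,
*Functions of One Complex Variable I* (1978), IX.1.1.
-/

noncomputable section

open scoped Topology ComplexConjugate
open Filter Set Metric Complex
open UpperHalfPlane (upperHalfPlaneSet)
open Literature.Probability.RandomPlanarGeometry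
open Summit.CriticalPhenomena.SAWScalingLimit.Theorems.PickHalfPlane

namespace Summit.CriticalPhenomena.SAWScalingLimit.Theorems.PolygonParitySqueeze.GateStability

/-! ### 1. The Carathéodory extension of a frame is injective off the root -/

/-- **Injective Carathéodory extension of the conformal frame.** For a Dobrushin domain `D` and a
conformal equivalence `Φ : Ω → ℍₒ` of its carrier with `‖Φ‖ → ∞` at the root `D.pt 0` (within
`Ω`), there is `Φ* : ℂ → ℂ`, continuous AND INJECTIVE on `closure Ω ∖ {D.pt 0}`, equal to `Φ` on
`Ω`, and real on `∂Ω`.  (As `Identification.exists_frameExtension`: `Φ* = cayley⁻¹ ∘ Ψ⁻¹` for the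
Carathéodory homeomorphism `Ψ` of the closed disc onto `closure Ω`; `Ψ⁻¹` is injective and only
the root is sent to `1`, off which `cayley⁻¹` is injective.) [cite: PommerenkeBBCM1992, Thm. 2.6] -/
theorem exists_frameExtension_injOn (D : DobrushinDomain)
    (Φ : ConformalEquiv D.carrier upperHalfPlaneSet)
    (hΦ : Tendsto (fun z => ‖Φ z‖) (𝓝[D.carrier] (D.pt 0)) atTop) :
    ∃ Φs : ℂ → ℂ, ContinuousOn Φs (closure D.carrier \ {D.pt 0}) ∧ EqOn Φs Φ D.carrier ∧
      (∀ p ∈ frontier D.carrier, (Φs p).im = 0) ∧ InjOn Φs (closure D.carrier \ {D.pt 0}) := by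
  obtain ⟨Ψ, hΨ⟩ := JordanDomain.exists_isDiscExtension
    JordanDomain.exists_continuousOn_extension_holds Φ.symm
  set g : ℂ → ℂ := Function.invFunOn Ψ (closedBall 0 1) with hg
  set Φs : ℂ → ℂ := fun p => cayleyInvFun (g p) with hΦs
  have hinv : InvOn g Ψ (closedBall 0 1) (closure D.carrier) := hΨ.bijOn.invOn_invFunOn
  have hgΨ : ∀ p ∈ closure D.carrier, Ψ (g p) = p := fun p hp => hinv.2 hp
  have hcl0 : D.pt 0 ∈ closure D.carrier := frontier_subset_closure (D.pt_mem_frontier 0)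
  -- on the carrier `g = cayleyFun ∘ Φ`, so `Φs = Φ`
  have hgcar : ∀ z ∈ D.carrier, g z = cayleyFun (Φ z) := by
    intro z hz
    have hw : 0 < (Φ z).im := Φ.mapsTo hz
    have h1 : Ψ (cayleyFun (Φ z)) = z := by
      rw [← hΨ.boundaryExtension_eq hw.le, Φ.symm.boundaryExtension_eq (Φ.mapsTo hz),
        Φ.symm_apply_apply hz]
    have h2 := hΨ.bijOn.injOn.leftInvOn_invFunOn
      (mem_closedBall_zero_iff.2 (norm_cayleyFun_le_one hw.le))
    rw [h1] at h2
    exact h2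
  have heq : EqOn Φs Φ D.carrier := by
    intro z hz
    have hw : 0 < (Φ z).im := Φ.mapsTo hz
    simp only [hΦs]
    rw [hgcar z hz, cayleyInvFun_cayleyFun (add_I_ne_zero hw.le)]
  -- `g`, hence `Φs` off `g ⁻¹ {1}`, is continuous on `closure Ω`
  have hgc : ContinuousOn g (closure D.carrier) := by
    rw [hg, ← hΨ.bijOn.image_eq]
    exact IsCompact.continuousOn_invFunOn (isCompact_closedBall 0 1) hΨ.continuousOn
      hΨ.bijOn.injOn
  have hΦsc : ContinuousOn Φs {p ∈ closure D.carrier | g p ≠ 1} :=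
    differentiableOn_cayleyInvFun.continuousOn.comp (hgc.mono (sep_subset _ _)) fun p hp => hp.2
  -- the root is the preimage of `1`: otherwise `Φ` would have a finite limit there
  have hg0 : g (D.pt 0) = 1 := by
    by_contra hne
    haveI : NeBot (𝓝[D.carrier] (D.pt 0)) := mem_closure_iff_nhdsWithin_neBot.1 hcl0
    have hsub : D.carrier ⊆ {p ∈ closure D.carrier | g p ≠ 1} := fun z hz =>
      ⟨subset_closure hz, by rw [hgcar z hz]; exact cayleyFun_ne_one _⟩
    have h1 : Tendsto Φs (𝓝[D.carrier] (D.pt 0)) (𝓝 (Φs (D.pt 0))) :=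
      ((hΦsc (D.pt 0) ⟨hcl0, hne⟩).mono hsub).tendsto
    have h2 : Tendsto (fun z => ‖Φ z‖) (𝓝[D.carrier] (D.pt 0)) (𝓝 ‖Φs (D.pt 0)‖) :=
      (h1.congr' (eventually_mem_nhdsWithin.mono fun z hz => heq hz)).norm
    exact h2.not_tendsto (disjoint_nhds_atTop _) hΦ
  have hgne : ∀ p ∈ closure D.carrier \ {D.pt 0}, g p ≠ 1 := by
    rintro p ⟨hp, hp0⟩ h1
    apply hp0
    rw [mem_singleton_iff]
    calc p = Ψ (g p) := (hgΨ p hp).symm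
      _ = Ψ (g (D.pt 0)) := by rw [h1, hg0]
      _ = D.pt 0 := hgΨ _ hcl0
  refine ⟨Φs, hΦsc.mono fun p hp => ⟨hp.1, hgne p hp⟩, heq, fun p hp => ?_, ?_⟩
  · exact cayleyInvFun_im_eq_zero (mem_sphere_zero_iff_norm.1 (hΨ.invFunOn_mem_sphere hp).1)
  · intro p hp q hq hpq
    have h1 : g p = g q := by
      have := congrArg cayleyFun hpq
      simp only [hΦs] at this
      rwa [cayleyFun_cayleyInvFun (hgne p hp), cayleyFun_cayleyInvFun (hgne q hq)] at this
    calc p = Ψ (g p) := (hgΨ p hp.1).symm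
      _ = Ψ (g q) := by rw [h1]
      _ = q := hgΨ q hq.1

/-! ### 2. Elementary facts on a flat disc -/

/-- Under local flatness `Ω ∩ B(c, s) = {im > im c} ∩ B(c, s)`, membership in `Ω` of a point of
the disc is decided by its height. [folklore] -/
theorem mem_iff_of_flat {Ω : Set ℂ} {c : ℂ} {s : ℝ}
    (hflat : Ω ∩ ball c s = {z : ℂ | c.im < z.im} ∩ ball c s) {z : ℂ} (hz : z ∈ ball c s) :
    z ∈ Ω ↔ c.im < z.im := by
  have h := Set.ext_iff.1 hflat z
  simp only [mem_inter_iff, mem_setOf_eq] at h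
  exact ⟨fun h' => (h.1 ⟨h', hz⟩).1, fun h' => (h.2 ⟨h', hz⟩).1⟩

/-- Under local flatness of an OPEN set `Ω`, the points of the diameter are frontier points.
[folklore] -/
theorem mem_frontier_of_flat {Ω : Set ℂ} (hΩ : IsOpen Ω) {c : ℂ} {s : ℝ}
    (hflat : Ω ∩ ball c s = {z : ℂ | c.im < z.im} ∩ ball c s) {z : ℂ} (hz : z ∈ ball c s)
    (hzim : z.im = c.im) : z ∈ frontier Ω := by
  rw [frontier, hΩ.interior_eq]
  refine ⟨Identification.mem_closure_of_flat hflat hz hzim, fun hzU => ?_⟩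
  have h := (mem_iff_of_flat hflat hz).1 hzU
  rw [hzim] at h
  exact lt_irrefl _ h

/-- The horizontal diameter `{im = im c} ∩ B(c, s)` of a disc is preconnected (it is convex).
[folklore] -/
theorem isPreconnected_diameter (c : ℂ) (s : ℝ) :
    IsPreconnected ({z : ℂ | z.im = c.im} ∩ ball c s) := by
  refine (Convex.inter ?_ (convex_ball c s)).isPreconnected
  have : {z : ℂ | z.im = c.im} = {z : ℂ | z.im ≤ c.im} ∩ {z : ℂ | c.im ≤ z.im} := by
    ext z; simp only [mem_setOf_eq, mem_inter_iff]; constructor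
    · intro h; exact ⟨h.le, h.ge⟩
    · rintro ⟨h1, h2⟩; exact le_antisymm h1 h2
  rw [this]
  exact (convex_halfSpace_im_le _).inter (convex_halfSpace_im_ge _)

/-! ### 3. Schwarz reflection of the frame across the flat gate -/

/-- **Schwarz reflection of a conformal frame across the flat gate.** Let `D` be a Dobrushin
domain whose carrier `Ω` is the open upper half-disc above `b = D.pt 1` inside `B(b, s)`, with the
root `D.pt 0 ∉ B(b, s)`, and let `Φ : Ω → ℍₒ` be a conformal equivalence with `‖Φ‖ → ∞` at the root
and boundary value `0` at `b` (within `Ω`).  Then there is `F : ℂ → ℂ`, HOLOMORPHIC AND INJECTIVE on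
the full disc `B(b, s)`, equal to `Φ` on the upper half-disc `Ω ∩ B(b, s)`, with `F b = 0`, real on
the diameter `{im = im b}`, and with REAL POSITIVE derivative along the diameter.  (Reflection of
the injective Carathéodory extension `exists_frameExtension_injOn` across the diameter,
`Complex.differentiableOn_schwarzReflection`; injectivity from the sign of the imaginary part off
the diameter; `F'(b) > 0` by the boundary Hopf lemma `deriv_ne_zero_of_im_pos` and `Im Φ > 0`;
positivity along the whole diameter because `F'` is real and zero-free there, by the intermediate
value theorem.) [cite: PommerenkeBBCM1992, Thm. 2.6] -/
theorem exists_gateReflection (D : DobrushinDomain) {s : ℝ} (hs : 0 < s)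
    (hflat : D.carrier ∩ ball (D.pt 1) s = {z : ℂ | (D.pt 1).im < z.im} ∩ ball (D.pt 1) s)
    (h0 : D.pt 0 ∉ ball (D.pt 1) s)
    (Φ : ConformalEquiv D.carrier upperHalfPlaneSet)
    (hΦ0 : Tendsto (fun z => ‖Φ z‖) (𝓝[D.carrier] (D.pt 0)) atTop)
    (hΦ1 : Φ.HasBoundaryValue (D.pt 1) 0) :
    ∃ F : ℂ → ℂ, DifferentiableOn ℂ F (ball (D.pt 1) s) ∧ InjOn F (ball (D.pt 1) s) ∧
      EqOn F Φ (D.carrier ∩ ball (D.pt 1) s) ∧ F (D.pt 1) = 0 ∧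
      (∀ z ∈ ball (D.pt 1) s, z.im = (D.pt 1).im → (F z).im = 0) ∧
      (∀ z ∈ ball (D.pt 1) s, z.im = (D.pt 1).im → 0 < (deriv F z).re ∧ (deriv F z).im = 0) := by
  obtain ⟨Φs, hΦsc, hΦse, hΦsr, hΦsi⟩ := exists_frameExtension_injOn D Φ hΦ0
  set b : ℂ := D.pt 1 with hbdef
  have hU : IsOpen D.carrier := D.isOpen
  have hb0 : b ≠ D.pt 0 := fun h => absurd (D.pt_injective h) (by decide)
  have hbcl : b ∈ closure D.carrier := frontier_subset_closure (D.pt_mem_frontier 1)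
  -- membership in the flat disc
  have hcar : ∀ z ∈ ball b s, (z ∈ D.carrier ↔ b.im < z.im) := fun z hz => mem_iff_of_flat hflat hz
  have hclos : ∀ z ∈ ball b s, b.im ≤ z.im → z ∈ closure D.carrier \ {D.pt 0} := by
    intro z hz hzim
    refine ⟨?_, fun h => h0 (mem_singleton_iff.1 h ▸ hz)⟩
    rcases hzim.lt_or_eq with hlt | heq
    · exact subset_closure ((hcar z hz).2 hlt)
    · exact Identification.mem_closure_of_flat hflat hz heq.symm
  have hfront : ∀ z ∈ ball b s, z.im = b.im → z ∈ frontier D.carrier := fun z hz hzim =>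
    mem_frontier_of_flat hU hflat hz hzim
  -- `Φs b = 0`
  have hΦsb : Φs b = 0 := by
    haveI : NeBot (𝓝[D.carrier] b) := mem_closure_iff_nhdsWithin_neBot.1 hbcl
    have hsub : D.carrier ⊆ closure D.carrier \ {D.pt 0} := fun z hz =>
      ⟨subset_closure hz, fun h => by
        have h' : D.pt 0 ∈ D.carrier := mem_singleton_iff.1 h ▸ hz
        have := D.pt_mem_frontier 0
        rw [frontier, hU.interior_eq] at this
        exact this.2 h'⟩
    have h1 : Tendsto Φs (𝓝[D.carrier] b) (𝓝 (Φs b)) :=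
      ((hΦsc b ⟨hbcl, fun h => hb0 (mem_singleton_iff.1 h)⟩).mono hsub).tendsto
    have h2 : Tendsto Φ (𝓝[D.carrier] b) (𝓝 (Φs b)) :=
      h1.congr' (eventually_mem_nhdsWithin.mono fun z hz => hΦse hz)
    exact tendsto_nhds_unique h2 hΦ1
  -- translate to the origin and reflect across the real axis
  have hball : ∀ w : ℂ, w ∈ ball (0 : ℂ) s ↔ w + b ∈ ball b s := fun w => by
    rw [mem_ball_zero_iff, mem_ball, dist_eq_norm, add_sub_cancel_right]
  have hmemU : ∀ w ∈ ball (0 : ℂ) s, 0 < w.im → w + b ∈ D.carrier := fun w hw hwim =>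
    (hcar (w + b) ((hball w).1 hw)).2 (by simpa using hwim)
  set f₀ : ℂ → ℂ := fun w => Φs (w + b) with hf₀
  have hsymm : ∀ w ∈ ball (0 : ℂ) s, conj w ∈ ball (0 : ℂ) s := fun w hw => by
    rwa [mem_ball_zero_iff, norm_conj, ← mem_ball_zero_iff]
  have hc : ContinuousOn f₀ (ball (0 : ℂ) s ∩ {w | 0 ≤ w.im}) := by
    refine hΦsc.comp (continuous_id.add continuous_const).continuousOn ?_
    rintro w ⟨hw, hwim⟩
    exact hclos (w + b) ((hball w).1 hw) (by simpa using hwim)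
  have hd : DifferentiableOn ℂ f₀ (ball (0 : ℂ) s ∩ {w | 0 < w.im}) := by
    rintro w ⟨hw, hwim⟩
    have hwy : w + b ∈ D.carrier := hmemU w hw hwim
    have h1 : DifferentiableAt ℂ Φs (w + b) :=
      ((Φ.differentiableOn _ hwy).differentiableAt (hU.mem_nhds hwy)).congr_of_eventuallyEq
        (Filter.eventuallyEq_of_mem (hU.mem_nhds hwy) hΦse)
    exact (h1.comp w (differentiableAt_id.add_const b)).differentiableWithinAt
  have hreal : ∀ w ∈ ball (0 : ℂ) s, w.im = 0 → conj (f₀ w) = f₀ w := by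
    intro w hw hwim
    refine conj_eq_iff_im.2 ?_
    exact hΦsr (w + b) (hfront (w + b) ((hball w).1 hw) (by simp [hwim]))
  set R : ℂ → ℂ := schwarzReflection f₀ with hRdef
  have hR : DifferentiableOn ℂ R (ball (0 : ℂ) s) :=
    differentiableOn_schwarzReflection isOpen_ball hsymm hc hd hreal
  have hRup : ∀ w ∈ ball (0 : ℂ) s, 0 < w.im → R w = Φ (w + b) := fun w hw hwim => by
    rw [hRdef, schwarzReflection_of_nonneg hwim.le]
    exact hΦse (hmemU w hw hwim)
  have hRreal : ∀ w ∈ ball (0 : ℂ) s, w.im = 0 → (R w).im = 0 := fun w hw hwim => by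
    rw [hRdef, schwarzReflection_of_nonneg hwim.symm.le]
    exact hΦsr (w + b) (hfront (w + b) ((hball w).1 hw) (by simp [hwim]))
  have hb0s : ball (0 : ℂ) s ∈ 𝓝 (0 : ℂ) := isOpen_ball.mem_nhds (mem_ball_self hs)
  -- the boundary Hopf lemma at the gate point: `R'(0) ≠ 0`, real
  have hR0 : deriv R 0 ≠ 0 ∧ (deriv R 0).im = 0 := by
    refine Identification.identification_gateHopf R 0 (by simp) (hR.analyticAt hb0s) ?_ ?_
    · filter_upwards [hb0s] with w hw hwim
      exact hRreal w hw hwim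
    · filter_upwards [hb0s] with w hw hwim
      rw [hRup w hw hwim]
      exact Φ.mapsTo (hmemU w hw hwim)
  -- and `R'(0) > 0`, since `Im R > 0` above the axis
  have hR0pos : 0 < (deriv R 0).re := by
    have hR00 : R 0 = 0 := by
      rw [hRdef, schwarzReflection_of_nonneg (by simp)]
      simpa [hf₀] using hΦsb
    have hRd0 : HasDerivAt R (deriv R 0) 0 := (hR.differentiableAt hb0s).hasDerivAt
    have h1 : Tendsto (fun z => R z / z) (𝓝[≠] 0) (𝓝 (deriv R 0)) := by
      refine hRd0.tendsto_slope_zero.congr' (eventually_nhdsWithin_of_forall fun z _ => ?_)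
      simp only [zero_add, hR00, sub_zero, smul_eq_mul, div_eq_inv_mul]
    have h2 : Tendsto (fun t : ℝ => (I * t : ℂ)) (𝓝[>] 0) (𝓝[≠] 0) := by
      refine tendsto_nhdsWithin_iff.2 ⟨?_, ?_⟩
      · have : Continuous fun t : ℝ => (I * t : ℂ) := by fun_prop
        simpa using (this.tendsto 0).mono_left nhdsWithin_le_nhds
      · filter_upwards [self_mem_nhdsWithin] with t ht
        exact mul_ne_zero I_ne_zero (ofReal_ne_zero.2 (ne_of_gt ht))
    have h3 := ((continuous_re.tendsto _).comp (h1.comp h2))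
    -- `re (R(it)/(it)) > 0` for small `t > 0`
    have hev : ∀ᶠ t : ℝ in 𝓝[>] 0, 0 < (R (I * t) / (I * t)).re := by
      have hev' : ∀ᶠ t : ℝ in 𝓝[>] 0, t < s := nhdsWithin_le_nhds (Iio_mem_nhds hs)
      filter_upwards [hev', self_mem_nhdsWithin] with t hts ht0
      have ht0 : 0 < t := ht0
      have hmem : (I * t : ℂ) ∈ ball (0 : ℂ) s := by
        rw [mem_ball_zero_iff, norm_mul, norm_I, one_mul, norm_real, Real.norm_of_nonneg ht0.le]
        exact hts
      have him : 0 < (I * t : ℂ).im := by simp [ht0]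
      have hpos : 0 < (R (I * t)).im := by
        rw [hRup _ hmem him]; exact Φ.mapsTo (hmemU _ hmem him)
      rw [im_eq_mul_re_div_I_mul (R (I * t)) ht0.ne'] at hpos
      exact pos_of_mul_pos_right hpos ht0.le
    have hge : 0 ≤ (deriv R 0).re := ge_of_tendsto h3 (hev.mono fun t ht => ht.le)
    rcases hge.lt_or_eq with hlt | heq
    · exact hlt
    · exact absurd (Complex.ext heq.symm (by simpa using hR0.2)) hR0.1
  -- the reflected frame `F z = R (z - b)`
  set F : ℂ → ℂ := fun z => R (z - b) with hFdef
  have hmaps : MapsTo (fun z : ℂ => z - b) (ball b s) (ball (0 : ℂ) s) := fun z hz => by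
    rw [hball, sub_add_cancel]; exact hz
  have hFd : DifferentiableOn ℂ F (ball b s) :=
    hR.comp (differentiableOn_id.sub_const b) hmaps
  have hFderiv : ∀ z, deriv F z = deriv R (z - b) := fun z => by
    rw [hFdef]; exact deriv_comp_sub_const R b z
  have hFup : ∀ z ∈ ball b s, b.im < z.im → F z = Φ z := fun z hz hzim => by
    have h := hRup (z - b) (hmaps hz) (by simpa [sub_im, sub_pos] using hzim)
    rwa [sub_add_cancel] at h
  have hFreal : ∀ z ∈ ball b s, z.im = b.im → (F z).im = 0 := fun z hz hzim =>
    hRreal (z - b) (hmaps hz) (by simp [hzim])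
  -- values: `im F ≥ 0` on the closed upper half-disc (`F = Φs`), `< 0` on the lower one
  have hFupper : ∀ z ∈ ball b s, b.im ≤ z.im → F z = Φs z := fun z hz hzim => by
    show R (z - b) = Φs z
    rw [hRdef, schwarzReflection_of_nonneg (by simpa [sub_im, sub_nonneg] using hzim)]
    simp [hf₀]
  have hFlower : ∀ z ∈ ball b s, z.im < b.im → F z = conj (Φs (conj (z - b) + b)) := fun z hz hzim => by
    show R (z - b) = _
    rw [hRdef, schwarzReflection_of_neg (by simpa [sub_im, sub_neg] using hzim)]
  have hreflmem : ∀ z ∈ ball b s, z.im < b.im → conj (z - b) + b ∈ D.carrier := fun z hz hzim =>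
    hmemU _ (hsymm _ (hmaps hz)) (by simp [sub_im]; linarith)
  have hFim_nonneg : ∀ z ∈ ball b s, b.im ≤ z.im → 0 ≤ (F z).im := by
    intro z hz hzim
    rcases hzim.lt_or_eq with hlt | heq
    · rw [hFup z hz hlt]; exact le_of_lt (Φ.mapsTo ((hcar z hz).2 hlt))
    · exact (hFreal z hz heq.symm).symm.le
  have hFim_neg : ∀ z ∈ ball b s, z.im < b.im → (F z).im < 0 := by
    intro z hz hzim
    rw [hFlower z hz hzim, conj_im, neg_lt_zero, hΦse (hreflmem z hz hzim)]
    exact Φ.mapsTo (hreflmem z hz hzim)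
  -- injectivity
  have hFinj : InjOn F (ball b s) := by
    intro z₁ hz₁ z₂ hz₂ heq
    by_cases h₁ : b.im ≤ z₁.im <;> by_cases h₂ : b.im ≤ z₂.im
    · rw [hFupper z₁ hz₁ h₁, hFupper z₂ hz₂ h₂] at heq
      exact hΦsi (hclos z₁ hz₁ h₁) (hclos z₂ hz₂ h₂) heq
    · exfalso
      have := hFim_nonneg z₁ hz₁ h₁
      rw [heq] at this
      exact absurd (hFim_neg z₂ hz₂ (not_le.1 h₂)) (not_lt.2 this)
    · exfalso
      have := hFim_nonneg z₂ hz₂ h₂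
      rw [← heq] at this
      exact absurd (hFim_neg z₁ hz₁ (not_le.1 h₁)) (not_lt.2 this)
    · rw [hFlower z₁ hz₁ (not_le.1 h₁), hFlower z₂ hz₂ (not_le.1 h₂)] at heq
      have h3 := hΦsi (hclos _ ((hball _).1 (hsymm _ (hmaps hz₁))) (le_of_lt (by
          simpa using (hcar _ ((hball _).1 (hsymm _ (hmaps hz₁)))).1 (hreflmem z₁ hz₁ (not_le.1 h₁)))))
        (hclos _ ((hball _).1 (hsymm _ (hmaps hz₂))) (le_of_lt (by
          simpa using (hcar _ ((hball _).1 (hsymm _ (hmaps hz₂)))).1 (hreflmem z₂ hz₂ (not_le.1 h₂)))))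
        ((starRingEnd ℂ).injective heq)
      have h4 : conj (z₁ - b) = conj (z₂ - b) := add_right_cancel h3
      have h5 : z₁ - b = z₂ - b := (starRingEnd ℂ).injective h4
      exact sub_left_injective h5
  -- derivative along the diameter: real, non-zero, positive at `b`, hence positive
  have hFdreal : ∀ z ∈ ball b s, z.im = b.im → (deriv F z).im = 0 := by
    intro z hz hzim
    rw [hFderiv]
    have hw : z - b ∈ ball (0 : ℂ) s := hmaps hz
    refine Identification.im_deriv_eq_zero_of_real (by simp [hzim])
      (hR.differentiableAt (isOpen_ball.mem_nhds hw)) ?_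
    filter_upwards [isOpen_ball.mem_nhds hw] with w hw' hwim
    exact hRreal w hw' hwim
  have hFdne : ∀ z ∈ ball b s, deriv F z ≠ 0 := fun z hz =>
    Literature.Analysis.Complex.SCV.deriv_ne_zero_of_injOn hFd isOpen_ball hFinj hz
  have hFdb : 0 < (deriv F b).re := by rw [hFderiv, sub_self]; exact hR0pos
  have hFdpos : ∀ z ∈ ball b s, z.im = b.im → 0 < (deriv F z).re := by
    intro z hz hzim
    by_contra hle
    push Not at hle
    -- intermediate value theorem for `re F'` along the diameter
    have hcont : ContinuousOn (fun w => (deriv F w).re) ({w : ℂ | w.im = b.im} ∩ ball b s) :=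
      (continuous_re.comp_continuousOn ((hFd.analyticOnNhd isOpen_ball).deriv.continuousOn)).mono
        inter_subset_right
    have hbmem : b ∈ {w : ℂ | w.im = b.im} ∩ ball b s := ⟨rfl, mem_ball_self hs⟩
    have hzmem : z ∈ {w : ℂ | w.im = b.im} ∩ ball b s := ⟨hzim, hz⟩
    obtain ⟨y, hy, hy0⟩ := (isPreconnected_diameter b s).intermediate_value hzmem hbmem hcont
      ⟨hle, hFdb.le⟩
    have : deriv F y = 0 := Complex.ext (by simpa using hy0) (by simpa using hFdreal y hy.2 hy.1)
    exact hFdne y hy.2 this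
  refine ⟨F, hFd, hFinj, fun z hz => hFup z hz.2 ((hcar z hz.2).1 hz.1), ?_, hFreal,
    fun z hz hzim => ⟨hFdpos z hz hzim, hFdreal z hz hzim⟩⟩
  show R (b - b) = 0
  rw [sub_self, hRdef, schwarzReflection_of_nonneg (by simp)]
  simpa [hf₀] using hΦsb

/-! ### Registered form -/

/-- **Registered helper `gateStability_gateReflection`** (∀-closed form of `exists_gateReflection`;
sub-goal of stub `stub_gateStability`, crux stmt-CriticalPhenomena-14004, line
`polygon-parity-squeeze`): the Schwarz reflection of a conformal frame across the flat gate is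
holomorphic and injective on the gate disc, vanishes at the gate point and has real positive
derivative along the gate. [cite: PommerenkeBBCM1992, Thm. 2.6] -/
theorem gateStability_gateReflection : ∀ (D : DobrushinDomain) (s : ℝ), 0 < s → D.carrier ∩ Metric.ball (D.pt 1) s = {z : ℂ | (D.pt 1).im < z.im} ∩ Metric.ball (D.pt 1) s → D.pt 0 ∉ Metric.ball (D.pt 1) s → ∀ (Φ : ConformalEquiv D.carrier UpperHalfPlane.upperHalfPlaneSet), Filter.Tendsto (fun z => ‖Φ z‖) (𝓝[D.carrier] (D.pt 0)) Filter.atTop → Φ.HasBoundaryValue (D.pt 1) 0 → ∃ F : ℂ → ℂ, DifferentiableOn ℂ F (Metric.ball (D.pt 1) s) ∧ Set.InjOn F (Metric.ball (D.pt 1) s) ∧ Set.EqOn F Φ (D.carrier ∩ Metric.ball (D.pt 1) s) ∧ F (D.pt 1) = 0 ∧ (∀ z ∈ Metric.ball (D.pt 1) s, z.im = (D.pt 1).im → (F z).im = 0) ∧ (∀ z ∈ Metric.ball (D.pt 1) s, z.im = (D.pt 1).im → 0 < (deriv F z).re ∧ (deriv F z).im = 0) :=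
  fun D _ hs hflat h0 Φ hΦ0 hΦ1 => exists_gateReflection D hs hflat h0 Φ hΦ0 hΦ1

end Summit.CriticalPhenomena.SAWScalingLimit.Theorems.PolygonParitySqueeze.GateStability

end
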